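import Literature.MathematicalPhysics.QuantumFieldTheory.Balaban1983to89.B15Prop1Thm1GeneralFormShapes
import Literature.MathematicalPhysics.QuantumFieldTheory.Balaban1983to89.B12ContinuousTransportInvarianceOn
import Literature.MathematicalPhysics.QuantumFieldTheory.Balaban1983to89.Node00.CriticalOnFibre

/-!
# `Balaban1983to89.B15Prop1Thm1RowsOfExistsUnique` — [Balaban1985Variational] = «[15]», Thm 1 p. 279 («there exists a minimal orbit in the space (8) … This orbit is a unique
# critical orbit in the space (6) if B₃ε₁ ≤ ε₀ and ε₀ ≤ a₀»), (1)–(7) pp. 277–278; [Balaban1988Convergent] = «[III]», (2.1) p. 254, (2.12)–(2.13) pp. 256–257, (2.18) p. 257;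
# [Balaban1989LargeFieldI] = «[IV]», (1.74) p. 192, p. 193, Prop. 1 p. 194; [Balaban1989LargeFieldII] = «[LF-II]», (1.12)–(1.13) p. 359:
# THE TWO THEOREM-1 ROWS (E) AND (T1@q₀) OF THE (J0′) PRODUCER OF RECORD, FOR EVERY BASE FIELD AT ONCE, FROM ONE CLOSED EXISTENCE ∕ UNIQUENESS LETTER

Honest framing: statement-level skeleton of published theorems with citation tags; proofs where landed; nothing here is a claim about the Yang–Mills mass gap.  Cell `pub-ymgap`
(HUMAN RULINGS D-0062 ∕ D-0149), lane `pub-ymgap-dag-n12-c` g27 (R134 seat (a), N12 = [B15], s1); count-neutral helper of K1⁹ `stmt-QuantumFields-27364` (`--kind proof --supports`);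
N12 NOT discharged; one finite 𝕋⁴ programme at fixed ε; nothing continuum ∕ ℝ⁴ ∕ OS ∕ mass-gap ∕ Clay.  THEOREMS ONLY (0 `def`, 0 `instance`, 0 `sorry`).

WHY.  The (J0′) producer of record of N12's Proposition-1 road («U2» `Summits/…/BalabanUVNodesN12MinimiserFamilyOfClassThresholdUniform` §2∕§3 p724662, «U3» `…DatumLettersUniform`
p725063; dag-n12-d's junctions (A″) p726379 ∕ (B″) p726412 at `reg' := closure` of the class) asks PER BASE FIELD `V_k`, besides datum letters, two rows of [15] Theorem 1:
(E) «∃ minimiser `U₀` of the Wilson action over NODE 00's (2.12) class `U_k({Ω_j(Z)}, εr)` with the (1.74) data `M˙(Q_k^{s*}(ext V_k))` on `𝐁_k(Z)`» and (T1@q₀) «every `U` in the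
closure of that class with the same data and `A(U) ≤ A(U₀)` is `U₀^u` for a gauge `u` whose scale-`j` images are EQUAL AND CENTRAL at the two ends of every constrained bond» (the
tower-CENTRAL reading of print's group (4); dag-n12-w1 `B15Prop1LocalChartFromThm1AtBaseCentral`: the residual reading is false on a disconnected tower-site graph).  THIS FILE derives
BOTH rows, for EVERY base field of the strict guard at once and every class tolerance `εr` below a second tolerance `ε₀ ≤ a₀`, from ONE closed instance-independent letter in NODE 00's
house shape — the existence ∕ uniqueness half of [15] Theorem 1 at NODE 00's objects over the torus class (shape (C) of `B15Prop1Thm1GeneralFormShapes`; the companion of K0⁷'s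
(R)-reading `Node00.VariationalThm1RegSepCoP7M`, antecedents VERBATIM): `h15EUT` = «for every length `k' ≤ m + K` with `LᵏʹM₁ ∣ 2L^{m+K}`, every separated (2.18) index `s` over
`fun n ↦ unionsOfCubes (LⁿM₁)`, `M₁ ≥ 1`, tolerances `0 < δ_j ≤ a₁`, `B₃δ_j ≤ ε₀ ≤ a₀` (two-sided comparability), every datum `W` with (7) on the support of record: (∃) a minimiser of `A`
over the class (6) at `ε₀` with the data `W` on `genSet s.Ω k'` exists, and (!) any two such minimisers differ by a gauge with equal, central scale-`j` images at the ends of every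
constrained bond».

THE DERIVATION (§3).  Fix an instance `(Z, Λ, k, lo, hi, ext)` of the knit, tolerances `0 < ε`, `(c_E+1)ε ≤ a₁`, `B₃(c_E+1)ε ≤ εr < ε₀ ≤ a₀`, a base field `V_k` in the strict guard.
(a) `ext V_k` is `(c_E+1)ε`-small on the `k`-plaquettes inside `Z` (g3 `B15ShellGauge193Local.dist1_plaqHol_extend_shellGauge_le`); (b) print's (7) for `M˙(Q_k^{s*}(ext V_k))` along `Z`'s
maximal sequence at the constant tolerance `(c_E+1)ε` (g11 `dataSmall7PTop_avgFamily_qsstarGIter0`, g12 `exists_seq_maxDomT`); (c) the `ε₀`-minimiser `U*` of (∃) is `B₃(c_E+1)ε`-regular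
by K0⁷'s (8)-letter `h15T` (the text of `thm1Guarded_of_thm1TorusClass` :507–522), hence in the class at `εr ⊆` the class at `ε₀`, so it minimises over the class at `εr`: (E); (d) for ANY
`εr`-minimiser `U₀` and any `U` in the CLOSURE of the `εr`-class (`⊆` the strict `ε₀`-class, §2: continuity of `dist1 ∘ plaqHol` and of `Node00.Sect2.coDivSum`) with the same data and
`A(U) ≤ A(U₀) = A(U*) = min`, both minimise over the `ε₀`-class and (!) gives the gauge: (T1@q₀).  §1 = the order bookkeeping on `IsMinimizer`; §4 = the letter in K0⁷'s own binder shape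
(over `SeqOfRecord`) serves `h15EUT` (the twin of dag-n12-d's `thm1TorusClass_of_variationalThm1RegSepCoP7M`), so a NODE 00 def with that body — node00-def's pen, NOT filed here —
would serve N12's rows BY NAME.  CONSUMER (optional, dag-n12-d (A″)∕(B″)): display `h15T` (already) + `h15EUT`, take `ε₀ := a₀`, feed `hbase`'s (E)∕(T1@q₀) per base field from §3.

HONEST SCOPE.  Bookkeeping by name over landed modules; [15] Theorem 1 ((8) = `h15T`, existence ∕ uniqueness = `h15EUT`) stays DISPLAYED, nothing of Bałaban's asserted; the uniqueness
clause is the WEAKER tower-central one (central ⊇ residual); count-neutral; N12 NOT discharged; K0⁷ ∕ K1⁹ NOT closed; counts unmoved; R4 closes only the conditional finite-𝕋⁴ rung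
`BalabanLadder.UV` — no summit statement is proved here and NOT the Yang–Mills mass gap (Clay); nothing continuum ∕ ℝ⁴ ∕ OS.
-/

noncomputable section

open Set

namespace Literature.MathematicalPhysics.QuantumFieldTheory.Balaban1983to89.B15Prop1Thm1RowsOfExistsUnique

open T4Continuum B15DeterminingSets GaugeField B15Prop1Carrier B8Eq17ClassAkV1 BlockAveraging
open B14.Eq22Determines (blockIter IsBlockUnion)
open Literature.MathematicalPhysics.QuantumFieldTheory.BalabanImbrieJaffe1984to88.BIJ85Eq453GaugeField (qsstarGIter0)
open B15Prop1DatumSmall7AtZSequence B15Prop1Thm1GeneralFormAtZSequence B15Prop1Thm1GeneralFormShapes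
open B16Sect1Backgrounds (toMS)

/-! ## §1  Order bookkeeping on `IsMinimizer`: nested classes, the minimum value, and the Theorem-1 row from an existence ∕ uniqueness pair -/

section Order

variable {P : Params} {G : Type*} [GaugeGroup G] (av : ∀ j, Averaging P j G)

/-- A minimiser over a class `reg₀` that lies in a smaller class `reg ⊆ reg₀` minimises over `reg` (same data). [cite: Balaban1985Variational, (6),(8) pp.278–279 (bookkeeping: the
minimal orbit in (8) inside the space (6))] -/
theorem isMinimizer_of_mem_of_subset {reg reg₀ : Set (GaugeField P 0 G)} {𝔹 : DetSet P} {W : MSField P G} {U : GaugeField P 0 G}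
    (h : IsMinimizer av reg₀ 𝔹 W U) (hsub : reg ⊆ reg₀) (hU : U ∈ reg) : IsMinimizer av reg 𝔹 W U :=
  ⟨hU, h.2.1, fun U' hU' hW' => h.2.2 U' (hsub hU') hW'⟩

/-- A constrained configuration of the class whose action does not exceed a minimiser's is itself a minimiser. [cite: Balaban1985Variational, (5)–(6) p.278 (bookkeeping)] -/
theorem isMinimizer_of_le_of_isMinimizer {reg₀ : Set (GaugeField P 0 G)} {𝔹 : DetSet P} {W : MSField P G} {U U₁ : GaugeField P 0 G}
    (h : IsMinimizer av reg₀ 𝔹 W U₁) (hU : U ∈ reg₀) (hUW : AgreeOn 𝔹 (avgFamily av U) W) (hle : wilsonAction4 U ≤ wilsonAction4 U₁) :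
    IsMinimizer av reg₀ 𝔹 W U :=
  ⟨hU, hUW, fun U' hU' hW' => hle.trans (h.2.2 U' hU' hW')⟩

/-- If the larger class `reg₀ ⊇ reg` has a minimiser INSIDE `reg`, every minimiser over `reg` has the same action — the minimum over `reg₀`. [cite: Balaban1985Variational, Thm 1 (8)
p.279 (bookkeeping: the minimal orbit lies in the smaller space (8))] -/
theorem wilsonAction4_eq_of_isMinimizer_of_subset {reg reg₀ : Set (GaugeField P 0 G)} {𝔹 : DetSet P} {W : MSField P G} {U₀ U₁ : GaugeField P 0 G}
    (h₀ : IsMinimizer av reg 𝔹 W U₀) (h₁ : IsMinimizer av reg₀ 𝔹 W U₁) (hsub : reg ⊆ reg₀) (hU₁ : U₁ ∈ reg) :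
    wilsonAction4 U₀ = wilsonAction4 U₁ :=
  le_antisymm (h₀.2.2 U₁ hU₁ h₁.2.1) (h₁.2.2 U₀ (hsub h₀.1) h₀.2.1)

/-- Under the same hypothesis every minimiser over the smaller class `reg` is a minimiser over the larger class `reg₀`. [cite: Balaban1985Variational, Thm 1 (8) p.279 (bookkeeping)] -/
theorem isMinimizer_of_isMinimizer_of_subset {reg reg₀ : Set (GaugeField P 0 G)} {𝔹 : DetSet P} {W : MSField P G} {U₀ U₁ : GaugeField P 0 G}
    (h₀ : IsMinimizer av reg 𝔹 W U₀) (h₁ : IsMinimizer av reg₀ 𝔹 W U₁) (hsub : reg ⊆ reg₀) (hU₁ : U₁ ∈ reg) :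
    IsMinimizer av reg₀ 𝔹 W U₀ :=
  isMinimizer_of_le_of_isMinimizer av h₁ (hsub h₀.1) h₀.2.1 (wilsonAction4_eq_of_isMinimizer_of_subset av h₀ h₁ hsub hU₁).le

/-- ★ **THE THEOREM-1 ROW (T1@q₀) FROM AN EXISTENCE ∕ UNIQUENESS PAIR ON A LARGER CLASS** (generic lattice, group, classes, data; the conclusion relation `Rel` abstract):
for nested classes `reg ⊆ reg₀` and a reading class `reg' ⊆ reg₀`, if `reg₀` has a minimiser lying in `reg` (existence (8) + regularity) and any two minimisers over `reg₀` are
`Rel`-related (uniqueness in (6)), then for every minimiser `U₀` over `reg`, every `U ∈ reg'` with the same data and `A(U) ≤ A(U₀)` is `Rel`-related to `U₀` — both minimise over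
`reg₀`. [cite: Balaban1985Variational, Thm 1 p.279 («there exists a minimal orbit in the space (8) … This orbit is a unique critical orbit in the space (6)»); Balaban1988Convergent, (2.12) p.256] -/
theorem thm1Row_of_existsUnique {reg reg' reg₀ : Set (GaugeField P 0 G)} {𝔹 : DetSet P} {W : MSField P G}
    (Rel : GaugeField P 0 G → GaugeField P 0 G → Prop) (hsub : reg ⊆ reg₀) (hsub' : reg' ⊆ reg₀)
    (hex : ∃ U₁, IsMinimizer av reg₀ 𝔹 W U₁ ∧ U₁ ∈ reg)
    (huniq : ∀ U₁ U₂, IsMinimizer av reg₀ 𝔹 W U₁ → IsMinimizer av reg₀ 𝔹 W U₂ → Rel U₁ U₂)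
    {U₀ : GaugeField P 0 G} (h₀ : IsMinimizer av reg 𝔹 W U₀) :
    ∀ U ∈ reg', AgreeOn 𝔹 (avgFamily av U) W → wilsonAction4 U ≤ wilsonAction4 U₀ → Rel U U₀ := by
  intro U hU hUW hle
  obtain ⟨U₁, h₁, hU₁⟩ := hex
  have h₀' : IsMinimizer av reg₀ 𝔹 W U₀ := isMinimizer_of_isMinimizer_of_subset av h₀ h₁ hsub hU₁
  exact huniq U U₀ (isMinimizer_of_le_of_isMinimizer av h₀' (hsub' hU) hUW hle) h₀'

end Order

/-! ## §2  NODE 00's (2.12) class of record: monotone in its tolerance; the closure at a tolerance lies in the class at any larger tolerance -/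

section ClassFacts

open Literature.MathematicalPhysics.QuantumFieldTheory.Balaban1983to89.Node00 (SU)
open scoped Matrix.Norms.L2Operator

variable {F : T4Family} {N : ℕ} [NeZero N]

/-- `0 < η_j` (`η_j = L^{−j}`, `L ≥ 1`). [folklore] -/
private theorem eta_pos (K j : ℕ) : 0 < (F.P K).eta j := by
  have hL : (0 : ℝ) < (F.P K).L := by exact_mod_cast (F.P K).L_pos
  unfold Params.eta
  positivity

/-- **THE (2.12) CLASS ON A SUPPORT GROWS WITH ITS TOLERANCE**: `U_k({Ω_j}_{j=0}^k, εr) ⊆ U_k({Ω_j}_{j=0}^k, εs)` for `εr ≤ εs` (both halves (1.7), (1.9) are strict inequalities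
against `ε·η_j²`, `ε·η_j³`; the support is not read through `εreg`).  General `N`, general support `Ω₀`. [cite: Balaban1985Variational, (2), (6) p.278; Balaban1985RegularSpaces, (1.7), (1.9) p.77] -/
theorem regMSCoPOfRecordAt_mono_eps (ν : Node00.Stage7Numerics) (K k : ℕ) (Ω₀ : Set (Site (F.P K) 0)) (Ω : ℕ → Set (Site (F.P K) 0)) {εr εs : ℝ}
    (h : εr ≤ εs) :
    Node00.regMSCoPOfRecordAt F N {ν with εreg := εr} K k Ω₀ Ω ⊆ Node00.regMSCoPOfRecordAt F N {ν with εreg := εs} K k Ω₀ Ω := by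
  rintro U ⟨h7, h9⟩
  refine ⟨fun j hj p hp => (h7 j hj p hp).trans_le ?_, fun j hj => (h9 j hj).of_le ?_⟩
  · exact mul_le_mul_of_nonneg_right h (pow_nonneg (eta_pos K j).le 2)
  · exact mul_le_mul_of_nonneg_right h (pow_nonneg (eta_pos K j).le 3)

/-- The support of record does not read the class tolerance (`{ν with εreg := ε}.M₁ = ν.M₁`). [cite: Balaban1988Convergent, p.255 (bookkeeping)] -/
theorem suppDomOfRecord_with_eps (ν : Node00.Stage7Numerics) (K : ℕ) (Ω : ℕ → Set (Site (F.P K) 0)) (ε : ℝ) :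
    Node00.suppDomOfRecord F {ν with εreg := ε} K Ω = Node00.suppDomOfRecord F ν K Ω := rfl

/-- The class of record at `ν⟨εreg := ε⟩` is the class on the support of record at that tolerance (definitional). [cite: Balaban1985Variational, (2) p.278 (bookkeeping)] -/
theorem regMSCoPOfRecord_with_eps_eq (ν : Node00.Stage7Numerics) (K k : ℕ) (Ω : ℕ → Set (Site (F.P K) 0)) (ε : ℝ) :
    Node00.regMSCoPOfRecord F N {ν with εreg := ε} K k Ω = Node00.regMSCoPOfRecordAt F N {ν with εreg := ε} K k (Node00.suppDomOfRecord F ν K Ω) Ω := rfl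

/-- **THE CLASS OF RECORD GROWS WITH ITS TOLERANCE** (support of record). [cite: Balaban1985Variational, (2), (6) p.278; Balaban1988Convergent, p.255, (2.12) p.256] -/
theorem regMSCoPOfRecord_mono_eps (ν : Node00.Stage7Numerics) (K k : ℕ) (Ω : ℕ → Set (Site (F.P K) 0)) {εr εs : ℝ} (h : εr ≤ εs) :
    Node00.regMSCoPOfRecord F N {ν with εreg := εr} K k Ω ⊆ Node00.regMSCoPOfRecord F N {ν with εreg := εs} K k Ω := by
  rw [regMSCoPOfRecord_with_eps_eq, regMSCoPOfRecord_with_eps_eq]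
  exact regMSCoPOfRecordAt_mono_eps ν K k _ Ω h

/-- **THE CLASS LITERAL OF NODE 00's NAMED FACTS AT TOLERANCE `ε` IS THE CLASS OF RECORD AT `ν⟨εreg := ε⟩`** (definitional: `Sect2.omegaPlaqsTop Ω Ω₀ j = plaqsOf (topSeq Ω₀ Ω j)`,
`Sect2.CoDivClassOnTop` unfolds to the (1.9) clauses on `bondsOf (topSeq Ω₀ Ω j)`). [cite: Balaban1985Variational, (2), (6) p.278 (bookkeeping); Balaban1988Convergent, (2.12) p.256] -/
theorem setOf_class_eq_regMSCoPOfRecord (ν : Node00.Stage7Numerics) (K k : ℕ) (Ω : ℕ → Set (Site (F.P K) 0)) (ε : ℝ) :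
    {U : GaugeField (F.P K) 0 (SU N) |
        (∀ j, j ≤ k → PlaqSmallOn (Node00.Sect2.omegaPlaqsTop Ω (Node00.suppDomOfRecord F ν K Ω) j) (ε * (F.P K).eta j ^ 2) U) ∧
          Node00.Sect2.CoDivClassOnTop Ω (Node00.suppDomOfRecord F ν K Ω) k ε U} =
      Node00.regMSCoPOfRecord F N {ν with εreg := ε} K k Ω := rfl

/-- ★ **THE CLOSURE OF THE CLASS AT `εr` LIES IN THE (STRICT) CLASS AT ANY `εs > εr`** (general `N`, general support `Ω₀`): the closure of the strict class lies in its closed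
companion (`|U(∂p) − 1| ≤ εr·η_j²` and `‖η·(D^{η*}_U∂U)(b)‖ ≤ εr·η_j³` — finitely many non-strict inequalities between continuous functions: `continuous_dist1_SU`,
`continuous_plaqHol_SU`, node00-def-b11's `Node00.continuous_coDivSum`), and `εr·η < εs·η` (`η_j > 0`). [cite: Balaban1985Variational, (2), (6) p.278; Balaban1985RegularSpaces, (1.1)–(1.2) p.76, (1.7), (1.9) p.77] -/
theorem closure_regMSCoPOfRecordAt_subset_of_lt (ν : Node00.Stage7Numerics) (K k : ℕ) (Ω₀ : Set (Site (F.P K) 0)) (Ω : ℕ → Set (Site (F.P K) 0)) {εr εs : ℝ}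
    (h : εr < εs) :
    closure (Node00.regMSCoPOfRecordAt F N {ν with εreg := εr} K k Ω₀ Ω) ⊆ Node00.regMSCoPOfRecordAt F N {ν with εreg := εs} K k Ω₀ Ω := by
  -- the closed companion of the class at `εr`
  have hA : IsClosed {U : GaugeField (F.P K) 0 (SU N) | ∀ j, j ≤ k → ∀ p, p ∈ plaqsOf (Node00.topSeq Ω₀ Ω j) →
      dist1 (GaugeField.plaqHol U p) ≤ εr * (F.P K).eta j ^ 2} := by
    simp only [Set.setOf_forall]
    exact isClosed_iInter fun j => isClosed_iInter fun _ => isClosed_iInter fun p => isClosed_iInter fun _ =>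
      isClosed_le ((B12ContinuousTransportInvarianceOn.continuous_dist1_SU (N := N)).comp
        (B12ContinuousTransportInvarianceOn.continuous_plaqHol_SU (N := N) p)) continuous_const
  have hB : IsClosed {U : GaugeField (F.P K) 0 (SU N) | ∀ j, j ≤ k → ∀ b, b ∈ bondsOf (Node00.topSeq Ω₀ Ω j) →
      ‖Node00.Sect2.coDivSum U b.src b.dir‖ ≤ εr * (F.P K).eta j ^ 3} := by
    simp only [Set.setOf_forall]
    exact isClosed_iInter fun j => isClosed_iInter fun _ => isClosed_iInter fun b => isClosed_iInter fun _ =>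
      isClosed_le (Node00.continuous_coDivSum (N := N) b.src b.dir).norm continuous_const
  have hsub : Node00.regMSCoPOfRecordAt F N {ν with εreg := εr} K k Ω₀ Ω ⊆
      {U | ∀ j, j ≤ k → ∀ p, p ∈ plaqsOf (Node00.topSeq Ω₀ Ω j) → dist1 (GaugeField.plaqHol U p) ≤ εr * (F.P K).eta j ^ 2} ∩
        {U | ∀ j, j ≤ k → ∀ b, b ∈ bondsOf (Node00.topSeq Ω₀ Ω j) → ‖Node00.Sect2.coDivSum U b.src b.dir‖ ≤ εr * (F.P K).eta j ^ 3} :=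
    fun U hU => ⟨fun j hj p hp => (hU.1 j hj p hp).le, fun j hj b hb => (hU.2 j hj b hb).le⟩
  intro U hU
  obtain ⟨h7, h9⟩ := closure_minimal hsub (hA.inter hB) hU
  refine ⟨fun j hj p hp => (h7 j hj p hp).trans_lt ?_, fun j hj b hb => (h9 j hj b hb).trans_lt ?_⟩
  · exact mul_lt_mul_of_pos_right h (pow_pos (eta_pos K j) 2)
  · exact mul_lt_mul_of_pos_right h (pow_pos (eta_pos K j) 3)

/-- **THE CLOSURE OF THE CLASS OF RECORD AT `εr` LIES IN THE CLASS OF RECORD AT ANY `εs > εr`** (support of record). [cite: Balaban1985Variational, (2), (6) p.278; Balaban1988Convergent, p.255, (2.12) p.256] -/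
theorem closure_regMSCoPOfRecord_subset_of_lt (ν : Node00.Stage7Numerics) (K k : ℕ) (Ω : ℕ → Set (Site (F.P K) 0)) {εr εs : ℝ} (h : εr < εs) :
    closure (Node00.regMSCoPOfRecord F N {ν with εreg := εr} K k Ω) ⊆ Node00.regMSCoPOfRecord F N {ν with εreg := εs} K k Ω := by
  rw [regMSCoPOfRecord_with_eps_eq, regMSCoPOfRecord_with_eps_eq]
  exact closure_regMSCoPOfRecordAt_subset_of_lt ν K k _ Ω h

end ClassFacts

/-! ## §3  At print's (1.74) object: the rows (E) and (T1@q₀) of the (J0′) producer of record, for EVERY base field of the strict guard, from `h15T` + `h15EUT` -/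

section AtZ

open Classical
open Metric
open B14DomainGeom (IsUnionOfCubes)
open B15Eq112TorusCover (cover)
open B14.Eq213MaximalDomains (side)
open B14.Eq213DetSet B15Sect1Instances B16Sect1Wilson B16Sect1Backgrounds
open T4CubeChartGnomonic (SU2)
open T4AxialGaugeSmallField (castSite boxPlaqs)
open B15Extension193 (extend)
open B15ShellGauge193 (shellGauge)
open B15ShellGauge193Local (dist1_plaqHol_extend_shellGauge_le)

/-- ★★★ **THE ROWS (E) AND (T1@q₀) OF «(J0′) OF RECORD» FOR EVERY BASE FIELD OF THE STRICT GUARD, FROM TWO CLOSED [15] LETTERS** — K0⁷'s (8)-letter `h15T` ([15] Thm 1 (R) over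
the torus class, the text of `B15Prop1Thm1GeneralFormShapes.thm1Guarded_of_thm1TorusClass` :507–522) and the EXISTENCE ∕ UNIQUENESS letter `h15EUT` (same antecedents; conclusion
«∃ minimiser over class (6) at `ε₀`» ∧ «any two minimisers differ by a gauge with equal, central scale-`j` images at the two ends of every constrained bond»).  Per instance `i` of the
knit (`Z, Λ, k, lo, hi, ext`: the geometry rows of `nearValue_letter_of_thm1Guarded` VERBATIM), for every `0 < ε` with `(c_E+1)ε ≤ a₁`, every class tolerance `εr ≥ B₃(c_E+1)ε`, every
`ε₀` with `εr < ε₀ ≤ a₀`, and every base field `V_k` with `PlaqSmallOn (plaqsInside (pts k (Z ∩ Λᶜ))) ε V_k`: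
(E) `∃ U₀, IsMinimizer (M˙) (U_k({Ω_j(Z)}, εr)) (𝐁_k(Z)) (M˙(Q_k^{s*}(ext V_k))) U₀` — U2 :171–173 VERBATIM at `ν⟨εreg := εr⟩` — and, for EVERY such minimiser `U₀`,
(T1@q₀) over `reg' := closure (U_k({Ω_j(Z)}, εr))` — dag-n12-d (A″) :196–200 VERBATIM.
Proof: module docstring (a)–(d). [cite: Balaban1985Variational, (1) p.277, (2),(3),(5),(6),(7) p.278, Thm 1 (8) p.279; Balaban1988Convergent, (2.1) p.254, p.255, (2.12)–(2.13) pp.256–257, (2.18) p.257; Balaban1989LargeFieldI, (1.74) p.192, p.193 ll.14–20, Prop. 1 p.194; Balaban1989LargeFieldII, (1.12)–(1.13) p.359; Balaban1985RegularSpaces, (1.3)–(1.9) p.77] -/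
theorem thm1Rows_atZ_of_thm1TorusClass_existsUnique {F : T4Family} (ν : Node00.Stage7Numerics) (Kt : ℕ) (hd3 : 3 ≤ (F.P Kt).d) {ι : Type}
    (Z Λ : ι → Set (Site (F.P Kt) 0)) (k : ι → ℕ) (hk0 : ∀ i, 0 < k i) (hk : ∀ i, k i ≤ (F.P Kt).m + (F.P Kt).K)
    (lo hi : ι → Fin (F.P Kt).d → ℤ) (n : ι → ℕ) (hn : ∀ i κ, hi i κ ≤ lo i κ + n i)
    (hbox : ∀ i, pts (k i) (Λ i) = (castSite '' Set.Icc (lo i) (hi i) : Set (Site (F.P Kt) (k i))))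
    (hZ : ∀ i, (boxPlaqs (lo i - 1) (hi i + 1) : Set (Plaq (F.P Kt) (k i))) ⊆ plaqsInside (pts (k i) (Z i)))
    (hN5 : ∀ i κ, ((hi i κ - lo i κ + 1).toNat : ℤ) + 5 < (F.P Kt).sitesPerDir (k i))
    (ext : ∀ i, GaugeField (F.P Kt) (k i) SU2 → GaugeField (F.P Kt) (k i) SU2)
    (hext : ∀ i Vk, ext i Vk = extend (pts (k i) (Λ i)) (shellGauge Vk (lo i) (hi i)) Vk)
    (hlohi : ∀ i, lo i ≤ hi i)
    -- (Gᵃ) geometry of `Z`: a union of `k`-blocks; print's `M₁ ≥ 2` and the torus divisibility of the `LʲM₁`-cube partitions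
    (hZblk : ∀ i, IsBlockUnion (k i) (Z i))
    (hM2 : 2 ≤ ν.M₁) (hdiv : ∀ i, side (F.P Kt).L ν.M₁ (k i) ∣ (F.P Kt).sitesPerDir 0)
    -- bookkeeping constants
    {cE B₃ a₀ a₁ : ℝ} (hcE0 : 0 ≤ cE) (hcE : ∀ i, 12 * ((F.P Kt).d : ℝ) * ((n i : ℝ) + 2) ^ 2 ≤ cE)
    -- [15] THEOREM 1 (R) = (8), CLOSED, OVER NODE 00's TORUS CLASS (shape (C); K0⁷'s `VariationalThm1RegSepCoP7M` via dag-n12-d's `thm1TorusClass_of_variationalThm1RegSepCoP7M`)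
    (h15T : ∀ (k' : ℕ), k' ≤ (F.P Kt).m + (F.P Kt).K → side (F.P Kt).L ν.M₁ k' ∣ (F.P Kt).sitesPerDir 0 →
      ∀ (s : B14.Eq218Concrete.Seq (fun n : ℕ => Node00.unionsOfCubes (F.P Kt) (side (F.P Kt).L ν.M₁ n)) k'),
      Node00.Sect2.SeqSeparated ν.M₁ s → 0 < ν.M₁ →
      ∀ (ε₀ : ℝ) (δ : ℕ → ℝ), (∀ j, j ≤ k' → 0 < δ j ∧ δ j ≤ a₁ ∧ B₃ * δ j ≤ ε₀) → (∀ j, j < k' → δ j ≤ 2 * δ (j + 1)) →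
      (∀ j, j < k' → δ (j + 1) ≤ 2 * δ j) → ε₀ ≤ a₀ →
      ∀ W : MSField (F.P Kt) SU2,
        Node00.Sect2.DataSmall7PTop (Node00.avOfRecord F 2 Kt) s.Ω (Node00.suppDomOfRecord F ν Kt s.Ω) k' δ W →
        ∀ U₀ : GaugeField (F.P Kt) 0 SU2, IsMinimizer (Node00.avOfRecord F 2 Kt)
            {U | (∀ j, j ≤ k' → PlaqSmallOn (Node00.Sect2.omegaPlaqsTop s.Ω (Node00.suppDomOfRecord F ν Kt s.Ω) j)
                (ε₀ * (F.P Kt).eta j ^ 2) U) ∧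
              Node00.Sect2.CoDivClassOnTop s.Ω (Node00.suppDomOfRecord F ν Kt s.Ω) k' ε₀ U}
            (genSet s.Ω k') W U₀ →
          (∀ j, j ≤ k' → PlaqSmallOn (Node00.Sect2.omegaPlaqsTop s.Ω (Node00.suppDomOfRecord F ν Kt s.Ω) j)
              (B₃ * δ j * (F.P Kt).eta j ^ 2) U₀) ∧
            ∀ j, j ≤ k' → Node00.Sect2.CoDivSmallOn (Node00.Sect2.omegaBondsTop s.Ω (Node00.suppDomOfRecord F ν Kt s.Ω) j)
              (B₃ * δ j * (F.P Kt).eta j ^ 3) U₀)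
    -- [15] THEOREM 1, EXISTENCE OF THE MINIMAL ORBIT ∕ UNIQUENESS MODULO TOWER-CENTRAL GAUGES, CLOSED, OVER NODE 00's TORUS CLASS (shape (C); same antecedents)
    (h15EUT : ∀ (k' : ℕ), k' ≤ (F.P Kt).m + (F.P Kt).K → side (F.P Kt).L ν.M₁ k' ∣ (F.P Kt).sitesPerDir 0 →
      ∀ (s : B14.Eq218Concrete.Seq (fun n : ℕ => Node00.unionsOfCubes (F.P Kt) (side (F.P Kt).L ν.M₁ n)) k'),
      Node00.Sect2.SeqSeparated ν.M₁ s → 0 < ν.M₁ →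
      ∀ (ε₀ : ℝ) (δ : ℕ → ℝ), (∀ j, j ≤ k' → 0 < δ j ∧ δ j ≤ a₁ ∧ B₃ * δ j ≤ ε₀) → (∀ j, j < k' → δ j ≤ 2 * δ (j + 1)) →
      (∀ j, j < k' → δ (j + 1) ≤ 2 * δ j) → ε₀ ≤ a₀ →
      ∀ W : MSField (F.P Kt) SU2,
        Node00.Sect2.DataSmall7PTop (Node00.avOfRecord F 2 Kt) s.Ω (Node00.suppDomOfRecord F ν Kt s.Ω) k' δ W →
        (∃ U₀ : GaugeField (F.P Kt) 0 SU2, IsMinimizer (Node00.avOfRecord F 2 Kt)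
            {U | (∀ j, j ≤ k' → PlaqSmallOn (Node00.Sect2.omegaPlaqsTop s.Ω (Node00.suppDomOfRecord F ν Kt s.Ω) j)
                (ε₀ * (F.P Kt).eta j ^ 2) U) ∧
              Node00.Sect2.CoDivClassOnTop s.Ω (Node00.suppDomOfRecord F ν Kt s.Ω) k' ε₀ U}
            (genSet s.Ω k') W U₀) ∧
        ∀ U₁ U₂ : GaugeField (F.P Kt) 0 SU2,
          IsMinimizer (Node00.avOfRecord F 2 Kt)
            {U | (∀ j, j ≤ k' → PlaqSmallOn (Node00.Sect2.omegaPlaqsTop s.Ω (Node00.suppDomOfRecord F ν Kt s.Ω) j)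
                (ε₀ * (F.P Kt).eta j ^ 2) U) ∧
              Node00.Sect2.CoDivClassOnTop s.Ω (Node00.suppDomOfRecord F ν Kt s.Ω) k' ε₀ U}
            (genSet s.Ω k') W U₁ →
          IsMinimizer (Node00.avOfRecord F 2 Kt)
            {U | (∀ j, j ≤ k' → PlaqSmallOn (Node00.Sect2.omegaPlaqsTop s.Ω (Node00.suppDomOfRecord F ν Kt s.Ω) j)
                (ε₀ * (F.P Kt).eta j ^ 2) U) ∧
              Node00.Sect2.CoDivClassOnTop s.Ω (Node00.suppDomOfRecord F ν Kt s.Ω) k' ε₀ U}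
            (genSet s.Ω k') W U₂ →
          ∃ u : GaugeTransf (F.P Kt) 0 SU2,
            (∀ j, j ≤ k' → ∀ b ∈ bondsOf (genSet s.Ω k' j), toMS u j b.src = toMS u j b.tgt ∧ ∀ g : SU2, toMS u j b.src * g = g * toMS u j b.src) ∧
              gaugeAct u U₁ = U₂) :
    ∀ i (εr ε₀ ε : ℝ) (Vk : GaugeField (F.P Kt) (k i) SU2), 0 < ε → (cE + 1) * ε ≤ a₁ → B₃ * ((cE + 1) * ε) ≤ εr → εr < ε₀ → ε₀ ≤ a₀ →
      PlaqSmallOn (plaqsInside (pts (k i) (Z i ∩ (Λ i)ᶜ))) ε Vk →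
      (∃ U₀ : GaugeField (F.P Kt) 0 SU2,
          IsMinimizer (Node00.avOfRecord F 2 Kt) (Node00.regMSCoPOfRecord F 2 {ν with εreg := εr} Kt (k i) (maxDomT ν.M₁ (Z i))) (Bj ν.M₁ (Z i) (k i))
            (avgFamily (Node00.avOfRecord F 2 Kt) (qsstarGIter0 (k i) (ext i Vk))) U₀) ∧
      ∀ U₀ : GaugeField (F.P Kt) 0 SU2,
        IsMinimizer (Node00.avOfRecord F 2 Kt) (Node00.regMSCoPOfRecord F 2 {ν with εreg := εr} Kt (k i) (maxDomT ν.M₁ (Z i))) (Bj ν.M₁ (Z i) (k i))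
            (avgFamily (Node00.avOfRecord F 2 Kt) (qsstarGIter0 (k i) (ext i Vk))) U₀ →
        ∀ U ∈ closure (Node00.regMSCoPOfRecord F 2 {ν with εreg := εr} Kt (k i) (maxDomT ν.M₁ (Z i))),
          AgreeOn (Bj ν.M₁ (Z i) (k i)) (avgFamily (Node00.avOfRecord F 2 Kt) U) (avgFamily (Node00.avOfRecord F 2 Kt) (qsstarGIter0 (k i) (ext i Vk))) →
          wilsonAction4 U ≤ wilsonAction4 U₀ →
            ∃ u : GaugeTransf (F.P Kt) 0 SU2,
              (∀ j, j ≤ k i → ∀ b ∈ bondsOf (Bj ν.M₁ (Z i) (k i) j), toMS u j b.src = toMS u j b.tgt ∧ ∀ g : SU2, toMS u j b.src * g = g * toMS u j b.src) ∧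
                gaugeAct u U = U₀ := by
  intro i εr ε₀ ε Vk hε hεa₁ hεr hr₀ ha₀ hreg
  have hd : 2 ≤ (F.P Kt).d := by omega
  have hM : 1 ≤ ν.M₁ := le_trans one_le_two hM2
  have hki : 1 ≤ k i := hk0 i
  -- `Z`'s maximal sequence as a separated (2.18) index, with print's cube letters, re-indexed over NODE 00's torus class
  obtain ⟨s, hsΩ, -, hscube, hsep⟩ := exists_seq_maxDomT hM (Z i) (hdiv i)
  obtain ⟨s', hΩ'⟩ := exists_seq_torusClass_of_cubeLetters hM s hscube
  have hsep' : Node00.Sect2.SeqSeparated ν.M₁ s' := (seqSeparated_iff_of_Ω_eq ν.M₁ hΩ').2 hsep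
  have hw1 : s.Ω 1 = maxDomT ν.M₁ (Z i) 1 := hsΩ 1 le_rfl hki
  -- (a) the p. 193 extension is `(cE+1)ε`-small on the `k`-plaquettes inside `Z`
  have hN3 : ∀ κ, hi i κ - lo i κ + 3 < ((F.P Kt).sitesPerDir (k i) : ℤ) := fun κ => by
    have h5 := hN5 i κ
    have hle : lo i κ ≤ hi i κ := hlohi i κ
    rw [Int.toNat_of_nonneg (by linarith)] at h5
    linarith
  have hδ₀ : 0 < (cE + 1) * ε := by positivity
  have hV : PlaqSmallOn (plaqsInside (pts (k i) (Z i))) ((cE + 1) * ε) (ext i Vk) := by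
    intro p hp
    rw [hext]
    have h := (dist1_plaqHol_extend_shellGauge_le hd3 (hlohi i) (hn i) hN3 (hbox i) (hZ i) hε hreg).1 p hp
    calc dist1 (plaqHol (extend (pts (k i) (Λ i)) (shellGauge Vk (lo i) (hi i)) Vk) p)
        ≤ 12 * (F.P Kt).d * (n i + 2) ^ 2 * ε := h
      _ ≤ cE * ε := mul_le_mul_of_nonneg_right (hcE i) hε.le
      _ < (cE + 1) * ε := by nlinarith
  -- (b) print's (7) for the datum ALONG THE INDEX `s.Ω`
  have h0 : Node00.Sect2.printedPlaqsTop s.Ω (Node00.suppDomOfRecord F ν Kt s.Ω) (k i) ⊆ plaqsInside (Z i) := by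
    rw [printedPlaqsTop_congr hki hsΩ, Node00.suppDomOfRecord_congr (F := F) ν Kt hw1]
    exact printedPlaqsTop_maxDomT_subset_plaqsInside hM (hdiv i) hki (k i)
  have hsucc : ∀ m, m + 1 ≤ k i → Node00.Sect2.printedPlaqs s.Ω (k i) (m + 1) ⊆ plaqsInside (pts (m + 1) (Z i)) := by
    intro m hm
    refine (Node00.Sect2.printedPlaqs_subset_plaqsOf _ _ _).trans ?_
    refine (plaqsOf_mono (genSet_subset_pts_of_one_le s.Ω (k i) (Nat.succ_pos m))).trans ?_
    rw [hsΩ (m + 1) (Nat.succ_pos m) hm]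
    exact plaqsOf_pts_maxDomT_subset_plaqsInside hM2 (hdiv i) (Nat.succ_pos m) hm
  have h7 : Node00.Sect2.DataSmall7PTop (Node00.avOfRecord F 2 Kt) s.Ω (Node00.suppDomOfRecord F ν Kt s.Ω) (k i)
      (fun _ => (cE + 1) * ε) (avgFamily (Node00.avOfRecord F 2 Kt) (qsstarGIter0 (k i) (ext i Vk))) :=
    dataSmall7PTop_avgFamily_qsstarGIter0 hd ExpMeanLog.expMeanLogSU T3DescentFibreTower.expMeanLogSU_E_one rfl (hk i)
      s.Ω _ (Z i) (hZblk i) h0 hsucc (fun _ _ => hδ₀) (ext i Vk) (fun _ _ => hV)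
  -- numerics of the thresholds at `ε₀`
  have hnum : ∀ j, j ≤ k i → 0 < (cE + 1) * ε ∧ (cE + 1) * ε ≤ a₁ ∧ B₃ * ((cE + 1) * ε) ≤ ε₀ := fun j _ =>
    ⟨hδ₀, hεa₁, hεr.trans hr₀.le⟩
  -- the two [15] letters at the index `s'`, read back at `s.Ω`, applied to the (1.74) datum
  have h8 := h15T (k i) (hk i) (hdiv i) s' hsep' hM
  have hEU := h15EUT (k i) (hk i) (hdiv i) s' hsep' hM
  rw [hΩ'] at h8 hEU
  have h8W := h8 ε₀ (fun _ => (cE + 1) * ε) hnum (fun _ _ => by linarith) (fun _ _ => by linarith) ha₀ _ h7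
  obtain ⟨⟨Ustar, hUstar⟩, huniq⟩ := hEU ε₀ (fun _ => (cE + 1) * ε) hnum (fun _ _ => by linarith) (fun _ _ => by linarith) ha₀ _ h7
  clear h8 hEU
  -- (c) the (1.74) class and determining set at `maxDomT ν.M₁ Z` ARE those at the index `s`; the class literal at `ε₀` IS the class of record at `ν⟨εreg := ε₀⟩`
  rw [setOf_class_eq_regMSCoPOfRecord] at hUstar huniq h8W
  have hreg : ∀ e : ℝ, Node00.regMSCoPOfRecord F 2 {ν with εreg := e} Kt (k i) (maxDomT ν.M₁ (Z i)) =
      Node00.regMSCoPOfRecord F 2 {ν with εreg := e} Kt (k i) s.Ω := fun e => (regMSCoPOfRecord_congr F 2 _ Kt hki hsΩ).symm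
  have hB : Bj ν.M₁ (Z i) (k i) = genSet s.Ω (k i) := (genSet_congr hki hsΩ).symm
  -- the `ε₀`-minimiser `U*` is `B₃(cE+1)ε`-regular, hence in the class at `εr`
  have h8U := h8W Ustar hUstar
  have hUr : Ustar ∈ Node00.regMSCoPOfRecord F 2 {ν with εreg := εr} Kt (k i) s.Ω := by
    refine ⟨fun j hj p hp => ((h8U.1 j hj) p hp).trans_le ?_, fun j hj b hb => ((h8U.2 j hj) b hb).trans_le ?_⟩
    · exact mul_le_mul_of_nonneg_right hεr (pow_nonneg (eta_pos Kt j).le 2)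
    · exact mul_le_mul_of_nonneg_right hεr (pow_nonneg (eta_pos Kt j).le 3)
  have hsub : Node00.regMSCoPOfRecord F 2 {ν with εreg := εr} Kt (k i) s.Ω ⊆ Node00.regMSCoPOfRecord F 2 {ν with εreg := ε₀} Kt (k i) s.Ω :=
    regMSCoPOfRecord_mono_eps ν Kt (k i) s.Ω hr₀.le
  have hcl : closure (Node00.regMSCoPOfRecord F 2 {ν with εreg := εr} Kt (k i) s.Ω) ⊆ Node00.regMSCoPOfRecord F 2 {ν with εreg := ε₀} Kt (k i) s.Ω :=
    closure_regMSCoPOfRecord_subset_of_lt ν Kt (k i) s.Ω hr₀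
  refine ⟨⟨Ustar, ?_⟩, ?_⟩
  · -- (E) at `εr`
    rw [hreg εr, hB]
    exact isMinimizer_of_mem_of_subset (Node00.avOfRecord F 2 Kt) hUstar hsub hUr
  · -- (T1@q₀) at `εr`, for every minimiser `U₀`
    intro U₀ hU₀ U hU hUW hle
    rw [hreg εr, hB] at hU₀
    rw [hreg εr] at hU
    rw [hB] at hUW ⊢
    exact thm1Row_of_existsUnique (Node00.avOfRecord F 2 Kt)
      (fun U₁ U₂ => ∃ u : GaugeTransf (F.P Kt) 0 SU2,
        (∀ j, j ≤ k i → ∀ b ∈ bondsOf (genSet s.Ω (k i) j), toMS u j b.src = toMS u j b.tgt ∧ ∀ g : SU2, toMS u j b.src * g = g * toMS u j b.src) ∧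
          gaugeAct u U₁ = U₂)
      hsub hcl ⟨Ustar, hUstar, hUr⟩ huniq hU₀ U hU hUW hle

end AtZ

/-! ## §4  NODE 00's house shape: the (E/U) letter over the (2.18) index OF RECORD (K0⁷'s `VariationalThm1RegSepCoP7M` binders VERBATIM) serves the torus-class letter `h15EUT` -/

section HouseShape

open B14.Eq213MaximalDomains (side)
open T4CubeChartGnomonic (SU2)

/-- Along the flat history `g ≡ 1` the (2.5) factor is `R = 1` (`(log 1⁻²)^r = 0^r ≤ L⁰`; dag-n21-c's corner device, re-proved here for the Literature side).
[cite: Balaban1988Convergent, (2.5) p.255 (bookkeeping)] -/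
theorem RkOfRecord_at_flat (L r : ℕ) : Node00.RkOfRecord L r 1 = 1 := by
  have h0 : (Real.log ((1 : ℝ) ^ 2)⁻¹) ^ r ≤ ((L ^ 0 : ℕ) : ℝ) := by
    rw [one_pow, inv_one, Real.log_one, pow_zero, Nat.cast_one]
    exact pow_le_one₀ le_rfl zero_le_one
  have h : ∃ s : ℕ, (Real.log ((1 : ℝ) ^ 2)⁻¹) ^ r ≤ ((L ^ s : ℕ) : ℝ) := ⟨0, h0⟩
  simp only [Node00.RkOfRecord, dif_pos h, (Nat.find_eq_zero h).mpr h0, pow_zero]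

/-- **NODE 00's class of record `𝐃_j` at `(M, g) := (ν.M₁, 1)` is the torus-native class of `LʲM₁`-cube unions** (`dCubeSide L M₁ (R_j 1) j = Lʲ·M₁·1 = side L M₁ j`): the
house shape of `Node00.DOfRecord` meets shape (C) of `B15Prop1Thm1GeneralFormShapes` (dag-n12-d's `DOfRecord_self_one`, re-proved here for the Literature side).
[cite: Balaban1988Convergent, (2.1) p.254, (2.13) p.256; Balaban1985RegularSpaces, (1.3)–(1.6) p.77 (bookkeeping)] -/
theorem DOfRecord_at_flat {F : T4Family} (ν : Node00.Stage7Numerics) (K : ℕ) :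
    Node00.DOfRecord F ν ν.M₁ (fun _ => (1 : ℝ)) K = fun n => Node00.unionsOfCubes (F.P K) (side (F.P K).L ν.M₁ n) := by
  funext n
  rw [Node00.DOfRecord, RkOfRecord_at_flat, Node00.dCubeSide, side, Nat.mul_one]

/-- ★★ **THE (E/U) LETTER IN NODE 00's HOUSE SHAPE SERVES `h15EUT`**: the existence ∕ uniqueness sentence quantified EXACTLY like K0⁷'s `Node00.VariationalThm1RegSepCoP7M F 2 B₃ a₀ a₁`
(every numerics `ν`, basic cube size `M`, coupling history `g`, torus `K`, length `k`, separated (2.18) index `s : SeqOfRecord F ν M g K k` of record, `M₁ ≥ 1`, tolerances, datum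
with (7) on the support of record — the (R)-reading's antecedents VERBATIM, its conclusion replaced by «∃ minimiser over class (6) at `ε₀`» ∧ «any two minimisers differ by a gauge with
equal, central scale-`j` images at the two ends of every constrained bond») READ AT `(ν, M := ν.M₁, g := 1, K := Kt)` IS the torus-class letter `h15EUT` of §3 at `(ν, Kt)` (its two
guards idle): `DOfRecord_at_flat` + dag-n12-c g15's `exists_seq_reindex_Ω` ∕ `seqSeparated_iff_of_Ω_eq` (every reader of the body reads `s.Ω` only) — the twin of dag-n12-d's
`thm1TorusClass_of_variationalThm1RegSepCoP7M` for the (8)-letter.  So a NODE 00 def with this body (node00-def's pen; NOT filed here) would serve N12's (E)∕(T1@q₀) rows BY NAME.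
[cite: Balaban1985Variational, (1) p.277, Thm 1 (2),(3),(5),(6),(7),(8) pp.278–279; Balaban1988Convergent, (2.1) p.254, (2.5) p.255, (2.12)–(2.13) p.256, (2.18) p.257; Balaban1985RegularSpaces, (1.3)–(1.9) p.77 (bookkeeping)] -/
theorem thm1TorusClassEU_of_thm1RecordEU {F : T4Family} (ν : Node00.Stage7Numerics) (Kt : ℕ) {B₃ a₀ a₁ : ℝ}
    (h15EU : ∀ (ν' : Node00.Stage7Numerics) (M : ℕ) (g : ℕ → ℝ) (K k' : ℕ) (s : Node00.SeqOfRecord F ν' M g K k'),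
      Node00.Sect2.SeqSeparated ν'.M₁ s → 0 < ν'.M₁ →
      ∀ (ε₀ : ℝ) (δ : ℕ → ℝ), (∀ j, j ≤ k' → 0 < δ j ∧ δ j ≤ a₁ ∧ B₃ * δ j ≤ ε₀) → (∀ j, j < k' → δ j ≤ 2 * δ (j + 1)) →
      (∀ j, j < k' → δ (j + 1) ≤ 2 * δ j) → ε₀ ≤ a₀ →
      ∀ W : MSField (F.P K) SU2,
        Node00.Sect2.DataSmall7PTop (Node00.avOfRecord F 2 K) s.Ω (Node00.suppDomOfRecord F ν' K s.Ω) k' δ W →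
        (∃ U₀ : GaugeField (F.P K) 0 SU2, IsMinimizer (Node00.avOfRecord F 2 K)
            {U | (∀ j, j ≤ k' → PlaqSmallOn (Node00.Sect2.omegaPlaqsTop s.Ω (Node00.suppDomOfRecord F ν' K s.Ω) j)
                (ε₀ * (F.P K).eta j ^ 2) U) ∧
              Node00.Sect2.CoDivClassOnTop s.Ω (Node00.suppDomOfRecord F ν' K s.Ω) k' ε₀ U}
            (genSet s.Ω k') W U₀) ∧
        ∀ U₁ U₂ : GaugeField (F.P K) 0 SU2,
          IsMinimizer (Node00.avOfRecord F 2 K)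
            {U | (∀ j, j ≤ k' → PlaqSmallOn (Node00.Sect2.omegaPlaqsTop s.Ω (Node00.suppDomOfRecord F ν' K s.Ω) j)
                (ε₀ * (F.P K).eta j ^ 2) U) ∧
              Node00.Sect2.CoDivClassOnTop s.Ω (Node00.suppDomOfRecord F ν' K s.Ω) k' ε₀ U}
            (genSet s.Ω k') W U₁ →
          IsMinimizer (Node00.avOfRecord F 2 K)
            {U | (∀ j, j ≤ k' → PlaqSmallOn (Node00.Sect2.omegaPlaqsTop s.Ω (Node00.suppDomOfRecord F ν' K s.Ω) j)
                (ε₀ * (F.P K).eta j ^ 2) U) ∧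
              Node00.Sect2.CoDivClassOnTop s.Ω (Node00.suppDomOfRecord F ν' K s.Ω) k' ε₀ U}
            (genSet s.Ω k') W U₂ →
          ∃ u : GaugeTransf (F.P K) 0 SU2,
            (∀ j, j ≤ k' → ∀ b ∈ bondsOf (genSet s.Ω k' j), toMS u j b.src = toMS u j b.tgt ∧ ∀ g : SU2, toMS u j b.src * g = g * toMS u j b.src) ∧
              gaugeAct u U₁ = U₂) :
    ∀ (k' : ℕ), k' ≤ (F.P Kt).m + (F.P Kt).K → side (F.P Kt).L ν.M₁ k' ∣ (F.P Kt).sitesPerDir 0 →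
      ∀ (s : B14.Eq218Concrete.Seq (fun n : ℕ => Node00.unionsOfCubes (F.P Kt) (side (F.P Kt).L ν.M₁ n)) k'),
      Node00.Sect2.SeqSeparated ν.M₁ s → 0 < ν.M₁ →
      ∀ (ε₀ : ℝ) (δ : ℕ → ℝ), (∀ j, j ≤ k' → 0 < δ j ∧ δ j ≤ a₁ ∧ B₃ * δ j ≤ ε₀) → (∀ j, j < k' → δ j ≤ 2 * δ (j + 1)) →
      (∀ j, j < k' → δ (j + 1) ≤ 2 * δ j) → ε₀ ≤ a₀ →
      ∀ W : MSField (F.P Kt) SU2,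
        Node00.Sect2.DataSmall7PTop (Node00.avOfRecord F 2 Kt) s.Ω (Node00.suppDomOfRecord F ν Kt s.Ω) k' δ W →
        (∃ U₀ : GaugeField (F.P Kt) 0 SU2, IsMinimizer (Node00.avOfRecord F 2 Kt)
            {U | (∀ j, j ≤ k' → PlaqSmallOn (Node00.Sect2.omegaPlaqsTop s.Ω (Node00.suppDomOfRecord F ν Kt s.Ω) j)
                (ε₀ * (F.P Kt).eta j ^ 2) U) ∧
              Node00.Sect2.CoDivClassOnTop s.Ω (Node00.suppDomOfRecord F ν Kt s.Ω) k' ε₀ U}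
            (genSet s.Ω k') W U₀) ∧
        ∀ U₁ U₂ : GaugeField (F.P Kt) 0 SU2,
          IsMinimizer (Node00.avOfRecord F 2 Kt)
            {U | (∀ j, j ≤ k' → PlaqSmallOn (Node00.Sect2.omegaPlaqsTop s.Ω (Node00.suppDomOfRecord F ν Kt s.Ω) j)
                (ε₀ * (F.P Kt).eta j ^ 2) U) ∧
              Node00.Sect2.CoDivClassOnTop s.Ω (Node00.suppDomOfRecord F ν Kt s.Ω) k' ε₀ U}
            (genSet s.Ω k') W U₁ →
          IsMinimizer (Node00.avOfRecord F 2 Kt)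
            {U | (∀ j, j ≤ k' → PlaqSmallOn (Node00.Sect2.omegaPlaqsTop s.Ω (Node00.suppDomOfRecord F ν Kt s.Ω) j)
                (ε₀ * (F.P Kt).eta j ^ 2) U) ∧
              Node00.Sect2.CoDivClassOnTop s.Ω (Node00.suppDomOfRecord F ν Kt s.Ω) k' ε₀ U}
            (genSet s.Ω k') W U₂ →
          ∃ u : GaugeTransf (F.P Kt) 0 SU2,
            (∀ j, j ≤ k' → ∀ b ∈ bondsOf (genSet s.Ω k' j), toMS u j b.src = toMS u j b.tgt ∧ ∀ g : SU2, toMS u j b.src * g = g * toMS u j b.src) ∧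
              gaugeAct u U₁ = U₂ := by
  intro k' _ _ s hsep
  obtain ⟨s₁, hΩ₁, -⟩ := exists_seq_reindex_Ω s (Node00.DOfRecord F ν ν.M₁ (fun _ => (1 : ℝ)) Kt) fun j h1 hj => by
    rw [DOfRecord_at_flat]; exact s.chain.memΩ j h1 hj
  have h := h15EU ν ν.M₁ (fun _ => (1 : ℝ)) Kt k' s₁ ((seqSeparated_iff_of_Ω_eq ν.M₁ hΩ₁).2 hsep)
  rw [hΩ₁] at h
  exact h

end HouseShape

end Literature.MathematicalPhysics.QuantumFieldTheory.Balaban1983to89.B15Prop1Thm1RowsOfExistsUnique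

end
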